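import Summits.ABC.StewartYu.ArchG3RecLinesE
import HarnessLib

/-!
# The archimedean record `ArchG3Rec` — letter lines in closed form, file F: THE START PRINT `cPR`

Support file (theorems only; no named facts). Cell `abc-stewartyu`, route `YuMatveevShapeRat`, crux r2 `ArchCoreRat`
(stmt-ABC-20502), line `arch-g3-frame`, seam (B) of `stub_recLinesArch` (p5's closed letters of `ArchG3RecLinesClosed`).
* `junk_le`: the sub-unit debris of the letters (`X/8`, `n·WN`, `n·L/2^21`, `O(n)`, `log N`, `Σ A`, `wl 0·X`, `Z/2^21`) is `≤ Z/2^16`;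
* `logAmaxRR_le`: lp-1's START height in the order `T₀ := Tf 0 0`:
  `logAmaxRR ≤ T₀·(WN + 2 log N + log n! + 3 log(n+2) + 10n + 30) + (23/160)·T₀·X + (14/100 + n/(4(n+1)))·Z + debris`;
* `print_core_le` (generic in the box letter `f ≤ X/32`), `cPR_le`: **`cPR ≤ (51/25)·Z`** for `n ≥ 2`, given the factorial letter `log n! ≤ X/32` (`T₀ ≤ (33/2)(n+1)L`, `(n+1)·L·WN ≤ Z/64`,
  `(n+1)²·L ≤ Z/512`, `(n+1)·X·L = Z/8`).
The factorial letter isolates the only `n`-super-exponential atom of the closed lines (`(n−1)!` in `sRR`, `btR`): with the record's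
range floor `X ≥ 64(n+1)` it holds for `n ≤ 19`; it is discharged by any range floor `X ≥ c·n·log n` and disappears if the adjugate
letter of the shaped frame is sharpened from `(n−1)!·N` to `2^{n−1}·N` (p1 g11 finding, STATUS 21:45Z).

## References
* [Nesterenko2003] Yu. V. Nesterenko, LNM 1819 (2003) — §3.5 (3.37), Prop. 3.9.
-/

noncomputable section

open Finset Real
open scoped Nat
open Summit.ABC.StewartYu.ArchSupply (WC)
open Summit.ABC.StewartYu.ArchG3Setup (DΔC)

namespace Summit.ABC.StewartYu

namespace ArchG3Rec

open PadicG3Par (Cb Cb_pos)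
open ArchG3Par (G K yloadK G_eq G_pos K_pos yloadK_pos two_G_le_yloadK)

variable {n : ℕ} (P : ArchG3Rec n)

/-! ### Debris -/

/-- `wl 0·X ≤ Z/2^18` (`e^{G+2} ≥ (G+2)^4/24 ≥ 26^4/24`) and `0 < wl 0`. [folklore] -/
theorem wl_zero_X_le : P.wl 0 * P.X ≤ P.Z / 2 ^ 18 ∧ 0 < P.wl 0 := by
  have hw := (P.wl_facts 0).2
  have hG := (P.sixteen_le_G').1
  have hL := P.L_real.2.1
  have hX : (0 : ℝ) ≤ P.X := Nat.cast_nonneg _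
  refine ⟨?_, hw⟩
  -- `exp(G+2) ≥ (G+2)^4/4! ≥ 2^18·… /G`: need `G·2^18 ≤ exp(G+2)·1`… use `(G+2)^4/24 ≥ 2^18 G` for `G ≥ 16`? (18^4/24=4374 vs 2^18·16): no.
  -- Instead: `wl 0·X = L·X·e^{−(G+2)}` and `e^{G+2} ≥ (G+2)^6/720 ≥ 2^18·G` for `G ≥ 16` (`18^6/720 = 47239 ≥`… no). Use degree 8:
  -- `(G+2)^8/8! ≥ 2^18 G` ⇔ at `G = 16`: `18^8/40320 = 273k·… = 1.10e10/40320 = 2.73e5`, `2^18·16 = 4.19e6`: no. Degree 10: `18^10/10! = 3.57e12/3.63e6 = 9.8e5`: no.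
  -- So bound more modestly: `wl 0 · X ≤ Z/2^18` ⇔ `G e^{-(G+2)} ≤ 2^{-18}`… `e^{G+2} ≥ e^{18} ≈ 6.6e7 ≥ 2^18·G = 4.2e6` ✓ but needs a
  -- genuine numeric `e^{18}`: `e^{18} ≥ 2.7^{18}`; `2.7^18 = (58000000 : ℝ) ≥ 2^22·…`; we show `G·2^18 ≤ exp(G+2)` from `exp(G+2) = exp(18)·exp(G−16)`,
  -- `exp(G−16) ≥ 1 + (G − 16)`, `exp 18 ≥ 2.7^18 ≥ (58000000 : ℝ)`, and `G·2^18 ≤ 2^18(16 + (G−16)) ≤ (58000000 : ℝ) (1 + (G−16))` as `2^18·16 = 4.2e6 ≤ (58000000 : ℝ)`.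
  have h1 : Real.exp 18 ≥ (58000000 : ℝ) := by
    have h3 : Real.exp 18 = Real.exp 1 ^ 18 := by rw [← Real.exp_nat_mul]; norm_num
    rw [h3]
    have := Real.exp_one_gt_d9
    calc ((58000000 : ℝ) : ℝ) ≤ (2.7 : ℝ) ^ 18 := by norm_num
      _ ≤ Real.exp 1 ^ 18 := pow_le_pow_left₀ (by norm_num) (by linarith) 18
  have h2 : 1 + (G n - 16) ≤ Real.exp (G n - 16) := by have := Real.add_one_le_exp (G n - 16); linarith
  have h4 : Real.exp (G n + 2) = Real.exp 18 * Real.exp (G n - 16) := by rw [← Real.exp_add]; ring_nf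
  have h5 : G n * 2 ^ 18 ≤ Real.exp (G n + 2) := by
    rw [h4]
    have : G n * 2 ^ 18 ≤ (58000000 : ℝ) * (1 + (G n - 16)) := by nlinarith
    have h6 : ((58000000 : ℝ) : ℝ) * (1 + (G n - 16)) ≤ Real.exp 18 * Real.exp (G n - 16) :=
      mul_le_mul h1.le h2 (by linarith) (Real.exp_pos _).le
    linarith
  -- `wl 0 · X = L X exp(-(G+2))`, `Z = G X L`
  unfold wl Z
  simp only [pow_zero, div_one]
  rw [Real.exp_neg, le_div_iff₀ (by positivity)]
  have hE := Real.exp_pos (G n + 2)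
  have : (P.L : ℝ) * (Real.exp (G n + 2))⁻¹ * P.X * 2 ^ 18 = (P.X * P.L) * (2 ^ 18 / Real.exp (G n + 2)) := by ring
  rw [this]
  have h7 : (2 : ℝ) ^ 18 / Real.exp (G n + 2) ≤ G n := by
    rw [div_le_iff₀ hE]; nlinarith
  have hXL : (0 : ℝ) ≤ P.X * P.L := by positivity
  nlinarith [mul_le_mul_of_nonneg_left h7 hXL]

set_option maxHeartbeats 400000 in
/-- **the debris**: `X/8 + 12n + 40 + 2·log N + 2·ΣA + wl 0·X + Z/2^21 + n·(WN + L/2^21 + 1) ≤ Z/2^16`. [folklore] -/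
theorem junk_le : (P.X : ℝ) / 8 + 12 * n + 40 + 2 * Real.log P.N + 2 * P.SAR + P.wl 0 * P.X + P.Z / 2 ^ 21 +
    n * (P.WN + P.L / 2 ^ 21 + 1) ≤ P.Z / 2 ^ 16 := by
  obtain ⟨hZ0, hZW, hZn, hXL⟩ := P.Z_floors
  obtain ⟨-, -, hS⟩ := P.Amax_div_N_le
  have hwl := P.wl_zero_X_le.1
  have hlogN := P.WN_bounds.2.2.1
  have hWN1 := P.WN_bounds.1
  have hL := P.L_real
  have hG := G_pos n
  have hG16 := (P.sixteen_le_G').1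
  have hn1 : (1 : ℝ) ≤ n := by exact_mod_cast P.hn
  have hn0 : (0 : ℝ) ≤ n := by linarith
  have hL27 : (2 : ℝ) ^ 26 ≤ P.L := le_trans (pow_le_pow_right₀ (by norm_num) (by have := P.hn; omega)) hL.2.2.1
  -- `X = Z/(G L) ≤ Z/(16·2^26)`
  have hX : (P.X : ℝ) ≤ P.Z / 2 ^ 30 := by
    rw [le_div_iff₀ (by positivity)]
    have : (P.X : ℝ) * 2 ^ 30 ≤ P.X * (G n * P.L) := by
      apply mul_le_mul_of_nonneg_left _ (Nat.cast_nonneg _); nlinarith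
    unfold Z at *; nlinarith
  -- `n WN ≤ Z/(64 L) ≤ Z/2^32`, `log N ≤ WN ≤ Z/2^32`
  have hW : (n : ℝ) * P.WN + P.WN ≤ P.Z / 2 ^ 31 := by
    rw [le_div_iff₀ (by positivity)]
    have : ((n : ℝ) * P.WN + P.WN) * 2 ^ 31 = ((n : ℝ) + 1) * P.WN * 2 ^ 5 * 2 ^ 26 := by ring
    rw [this]
    have h2 : ((n : ℝ) + 1) * P.WN * 2 ^ 5 * 2 ^ 26 ≤ ((n : ℝ) + 1) * P.WN * 2 ^ 5 * P.L := by
      apply mul_le_mul_of_nonneg_left hL27; positivity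
    nlinarith
  -- `n L/2^21 + 12 n + 40 + n ≤ 53(n+1) L/2^21 …`: `(n+1) L ≤ Z/(512(n+1)) ≤ Z/1536`
  have hnL : ((n : ℝ) + 1) * P.L ≤ P.Z / 1024 := by
    rw [le_div_iff₀ (by positivity)]
    have h2 : (2 : ℝ) ≤ (n : ℝ) + 1 := by linarith
    have : ((n : ℝ) + 1) * P.L * 1024 = 512 * ((n : ℝ) + 1) * 2 * P.L := by ring
    nlinarith [mul_le_mul_of_nonneg_right h2 (show (0:ℝ) ≤ 512 * ((n : ℝ) + 1) * P.L by positivity)]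
  have h3 : (n : ℝ) * (P.L / 2 ^ 21) + 12 * n + 40 + n ≤ P.Z / 2 ^ 25 := by
    -- `12n + 40 + n ≤ 53 (n+1) ≤ 53(n+1)L/2^26`
    have h4 : 12 * (n : ℝ) + 40 + n ≤ 53 * (((n : ℝ) + 1) * P.L) / 2 ^ 26 := by
      rw [le_div_iff₀ (by positivity)]
      have : (12 * (n : ℝ) + 40 + n) * 2 ^ 26 ≤ 53 * ((n : ℝ) + 1) * 2 ^ 26 := by nlinarith
      have h5 : 53 * ((n : ℝ) + 1) * 2 ^ 26 ≤ 53 * ((n : ℝ) + 1) * P.L := by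
        apply mul_le_mul_of_nonneg_left hL27; positivity
      nlinarith
    have h6 : (n : ℝ) * (P.L / 2 ^ 21) ≤ ((n : ℝ) + 1) * P.L / 2 ^ 21 := by
      rw [mul_div_assoc']; apply div_le_div_of_nonneg_right _ (by positivity); nlinarith
    have h7 : ((n : ℝ) + 1) * P.L / 2 ^ 21 + 53 * (((n : ℝ) + 1) * P.L) / 2 ^ 26 ≤ P.Z / 2 ^ 25 := by
      rw [div_add_div _ _ (by positivity) (by positivity), div_le_div_iff₀ (by positivity) (by positivity)]
      nlinarith
    linarith
  have hS2 : 2 * P.SAR ≤ P.Z / 2 ^ 24 := by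
    -- `SAR ≤ n L WN/2^20 ≤ (Z/64)/2^20`
    have : (n : ℝ) * P.L * P.WN ≤ P.Z / 64 := by
      rw [le_div_iff₀ (by positivity)]; nlinarith
    have h8 : P.SAR ≤ P.Z / 64 / 2 ^ 20 := hS.trans (div_le_div_of_nonneg_right this (by positivity))
    rw [div_div] at h8
    have : P.Z / (64 * 2 ^ 20) = P.Z / 2 ^ 24 / 2 ^ 2 := by rw [div_div]; norm_num
    linarith [div_le_self hZ0.le (show (1:ℝ) ≤ 2 ^ 2 by norm_num), this]
  -- assemble
  have e : (P.X : ℝ) / 8 + 12 * n + 40 + 2 * Real.log P.N + 2 * P.SAR + P.wl 0 * P.X + P.Z / 2 ^ 21 +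
      n * (P.WN + P.L / 2 ^ 21 + 1) =
      (P.X : ℝ) / 8 + ((n : ℝ) * (P.L / 2 ^ 21) + 12 * n + 40 + n) + 2 * Real.log P.N + 2 * P.SAR + P.wl 0 * P.X +
        P.Z / 2 ^ 21 + n * P.WN := by ring
  rw [e]
  have h9 : 2 * Real.log (P.N : ℝ) + n * P.WN ≤ 2 * (P.Z / 2 ^ 31) := by nlinarith
  nlinarith

/-! ### The START height -/

/-- the middle block of `logAmaxRR`: `log 2 + (23/20)T₀H + (ŜT₀·log 2 + H/e + L₀(1 + log(1 + 2^Ŝ·Nf₀₀/H)))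
≤ (23/160)·T₀·X + T₀·(10n + 29 + log N) + (14/100)·Z + (X/8 + 10n + 36 + log N)`. [cite: Nesterenko2003, §3.5 (3.37); shape only] -/
theorem logAmaxRR_mid_le (hn2 : 2 ≤ n) :
    Real.log 2 + 23 / 20 * (P.Tf 0 0 : ℝ) * P.H +
      (((P.Sd * P.Tf 0 0 : ℕ) : ℝ) * Real.log 2 + P.H / Real.exp 1 +
        P.L₀ * (1 + Real.log (1 + (2 : ℝ) ^ P.Sd * (P.Nf 0 0 : ℝ) / P.H))) ≤
    23 / 160 * (P.Tf 0 0 : ℝ) * P.X + (P.Tf 0 0 : ℝ) * (10 * n + 29 + Real.log P.N) + 14 / 100 * P.Z +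
      ((P.X : ℝ) / 8 + 10 * n + 36 + Real.log P.N) := by
  obtain ⟨hH1, hHle, hHge⟩ := P.H_bounds
  obtain ⟨-, -, hL0⟩ := P.L₀_real_le
  have hLN := P.L₀_logN_le
  have hSd := P.Sd_log_le.2
  obtain ⟨-, -, -, hNf00, -⟩ := P.nodes_le 0 0
  have hZ0 := P.Z_floors.1
  have hy := yloadK_ge P.hn
  have hy0 := yloadK_pos n
  have hl2 : Real.log 2 ≤ (6932/10000 : ℝ) := by have := Real.log_two_lt_d9; linarith
  have hn : (2 : ℝ) ≤ n := by exact_mod_cast hn2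
  have hT0 : (0 : ℝ) ≤ P.Tf 0 0 := Nat.cast_nonneg _
  have hL00 : (0 : ℝ) ≤ P.L₀ := Nat.cast_nonneg _
  -- `(23/20) T₀ H ≤ (23/160) T₀ X`
  have hy8 : G n * P.X / (64 * (n + 1)) = (P.X : ℝ) / 8 := by rw [G_eq]; field_simp; ring
  rw [hy8] at hHle
  have h2 : 23 / 20 * (P.Tf 0 0 : ℝ) * P.H ≤ 23 / 160 * (P.Tf 0 0 : ℝ) * P.X := by
    have := mul_le_mul_of_nonneg_left hHle hT0; linarith
  -- `(Ŝ T₀) log 2 ≤ T₀ (10 n + 29 + log N)`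
  have h3 : ((P.Sd * P.Tf 0 0 : ℕ) : ℝ) * Real.log 2 ≤ P.Tf 0 0 * (10 * n + 29 + Real.log P.N) := by
    push_cast
    have := mul_le_mul_of_nonneg_left hSd hT0
    have e : ((P.Sd : ℝ) * P.Tf 0 0) * Real.log 2 = P.Tf 0 0 * (P.Sd * Real.log 2) := by ring
    linarith
  -- `H/e ≤ X/8`
  have h4 : (P.H : ℝ) / Real.exp 1 ≤ P.X / 8 :=
    (div_le_self (by linarith) (Real.one_le_exp (by norm_num))).trans hHle
  -- `L₀(1 + log(1 + 2^Ŝ Nf00/H)) ≤ (14/100) Z + 10 n + 35 + log N`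
  have hy16 : G n * P.X / (128 * (n + 1)) = (P.X : ℝ) / 16 := by rw [G_eq]; field_simp; ring
  rw [hy16] at hHge
  have hH0 : (0 : ℝ) < P.H := by linarith
  have h5a : 1 + (2 : ℝ) ^ P.Sd * (P.Nf 0 0 : ℝ) / P.H ≤ 17 * 2 ^ P.Sd := by
    have : (2 : ℝ) ^ P.Sd * (P.Nf 0 0 : ℝ) / P.H ≤ 2 ^ P.Sd * 16 := by
      rw [div_le_iff₀ hH0]
      have h2S : (0 : ℝ) ≤ 2 ^ P.Sd := by positivity
      have a1 := mul_le_mul_of_nonneg_left hNf00 h2S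
      have a2 : (P.X : ℝ) ≤ 16 * P.H := by linarith
      have a3 := mul_le_mul_of_nonneg_left a2 h2S
      linarith
    have h1S : (1 : ℝ) ≤ 2 ^ P.Sd := one_le_pow₀ (by norm_num)
    linarith
  have h5b : Real.log (1 + (2 : ℝ) ^ P.Sd * (P.Nf 0 0 : ℝ) / P.H) ≤ Real.log 17 + P.Sd * Real.log 2 := by
    have hpos : 0 < 1 + (2 : ℝ) ^ P.Sd * (P.Nf 0 0 : ℝ) / P.H := by positivity
    calc Real.log (1 + (2 : ℝ) ^ P.Sd * (P.Nf 0 0 : ℝ) / P.H) ≤ Real.log (17 * 2 ^ P.Sd) := Real.log_le_log hpos h5a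
      _ = Real.log 17 + P.Sd * Real.log 2 := by rw [Real.log_mul (by norm_num) (by positivity), Real.log_pow]
  have h17 : Real.log (17 : ℝ) ≤ (71/25 : ℝ) := by
    have e : Real.log (17 : ℝ) = 4 * Real.log 2 + Real.log (17 / 16) := by
      rw [show (17 : ℝ) = 2 ^ 4 * (17 / 16) by norm_num, Real.log_mul (by norm_num) (by norm_num), Real.log_pow]; push_cast; ring
    have : Real.log (17 / 16 : ℝ) ≤ 17 / 16 - 1 := Real.log_le_sub_one_of_pos (by norm_num)
    rw [e]; linarith
  have h5c : (P.L₀ : ℝ) * (1 + Real.log (1 + (2 : ℝ) ^ P.Sd * (P.Nf 0 0 : ℝ) / P.H)) ≤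
      P.L₀ * (10 * n + (821/25 : ℝ)) + P.L₀ * Real.log P.N := by
    have h5x : 1 + Real.log (1 + (2 : ℝ) ^ P.Sd * (P.Nf 0 0 : ℝ) / P.H) ≤ (10 * n + (821/25 : ℝ)) + Real.log P.N := by linarith
    have := mul_le_mul_of_nonneg_left h5x hL00
    linarith
  have h5d : (P.L₀ : ℝ) * (10 * n + (821/25 : ℝ)) ≤ (P.Z / (4 * yloadK n) + 1) * (10 * n + (821/25 : ℝ)) :=
    mul_le_mul_of_nonneg_right hL0 (by positivity)
  have h5e : P.Z / (4 * yloadK n) * (10 * n + (821/25 : ℝ)) + P.Z / (2 * yloadK n) ≤ 14 / 100 * P.Z := by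
    rw [G_eq] at hy
    have hq : ((10 : ℝ) * n + 821/25 + 2) / (4 * yloadK n) ≤ 14 / 100 := by
      rw [div_le_iff₀ (by positivity)]; linarith
    have e : P.Z / (4 * yloadK n) * (10 * n + (821/25 : ℝ)) + P.Z / (2 * yloadK n) =
        P.Z * (((10 : ℝ) * n + 821/25 + 2) / (4 * yloadK n)) := by
      field_simp; ring
    rw [e]
    have := mul_le_mul_of_nonneg_left hq hZ0.le
    linarith only [this]
  linarith only [h2, h3, h4, h5c, h5d, h5e, hLN, hl2]

/-- the box block of `logAmaxRR`: `2·Nf₀₀·Σⱼ(LνRR 0 j/N)·A j ≤ (n/(4(n+1)))·Z + Z/2^21` (`Nf₀₀ ≤ X`, `Σ ≤ (1+2^{-20}) n L`,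
`X·L = Z/(8(n+1))`). [folklore] -/
theorem logAmaxRR_box_le : 2 * (P.Nf 0 0 : ℝ) * ∑ j, (P.LνRR 0 j : ℝ) / P.N * P.A j ≤ n / (4 * ((n : ℝ) + 1)) * P.Z + P.Z / 2 ^ 21 := by
  obtain ⟨-, -, -, hNf00, -⟩ := P.nodes_le 0 0
  obtain ⟨-, hSum⟩ := P.sum_LνRR_A_le 0
  have hSum0 := (P.LνRR_A_le 0).2.2
  obtain ⟨hZ0, -, -, hXL⟩ := P.Z_floors
  simp only [pow_zero, div_one] at hSum
  have hX0 : (0 : ℝ) ≤ P.X := Nat.cast_nonneg _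
  have hn0 : (0 : ℝ) ≤ n := Nat.cast_nonneg n
  have hq : (P.X : ℝ) * P.L = P.Z / (8 * ((n : ℝ) + 1)) := by rw [hXL, G_eq]
  have h1 : 2 * (P.Nf 0 0 : ℝ) * ∑ j, (P.LνRR 0 j : ℝ) / P.N * P.A j ≤ 2 * P.X * ((1 + 1 / 2 ^ 20) * n * P.L) :=
    mul_le_mul (by linarith) hSum hSum0 (by positivity)
  have e1 : 2 * (P.X : ℝ) * ((1 + 1 / 2 ^ 20) * n * P.L) = (1 + 1 / 2 ^ 20) * (2 * n) * (P.X * P.L) := by ring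
  have e2 : (2 * (n : ℝ)) * (P.Z / (8 * ((n : ℝ) + 1))) = n / (4 * ((n : ℝ) + 1)) * P.Z := by
    field_simp; ring
  have hq2 : n / (4 * ((n : ℝ) + 1)) ≤ 1 / 2 := by
    rw [div_le_div_iff₀ (by positivity) (by norm_num)]; linarith
  have h3 : (1 + 1 / 2 ^ 20) * (2 * (n : ℝ)) * (P.X * P.L) = n / (4 * ((n : ℝ) + 1)) * P.Z + (n / (4 * ((n : ℝ) + 1)) * P.Z) / 2 ^ 20 := by
    rw [hq]
    have : (1 + 1 / 2 ^ 20) * (2 * (n : ℝ)) * (P.Z / (8 * ((n : ℝ) + 1))) =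
        (2 * (n : ℝ)) * (P.Z / (8 * ((n : ℝ) + 1))) + (2 * (n : ℝ)) * (P.Z / (8 * ((n : ℝ) + 1))) / 2 ^ 20 := by ring
    rw [this, e2]
  have h4 : (n / (4 * ((n : ℝ) + 1)) * P.Z) / 2 ^ 20 ≤ P.Z / 2 ^ 21 := by
    rw [div_le_div_iff₀ (by positivity) (by positivity)]
    have := mul_le_mul_of_nonneg_right hq2 hZ0.le
    nlinarith [this]
  linarith only [h1, e1, h3, h4]

/-- **lp-1's START height in closed form, bounded in the START order**:
`logAmaxRR ≤ T₀·(WN + 2·log N + log n! + 3·log(n+2) + 10n + 30) + (23/160)·T₀·X + (14/100 + n/(4(n+1)))·Z + debris`,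
`T₀ := Tf 0 0`, debris `= X/8 + 10n + 36 + log N + 2ΣA + wl 0·X + Z/2^21`. [cite: Nesterenko2003, §3.5 (3.37), Prop. 3.9; shape only] -/
theorem logAmaxRR_le (hn2 : 2 ≤ n) : P.logAmaxRR ≤
    (P.Tf 0 0 : ℝ) * (P.WN + 2 * Real.log P.N + Real.log (n ! : ℝ) + 3 * Real.log ((n : ℝ) + 2) + 10 * n + 30) +
      23 / 160 * (P.Tf 0 0 : ℝ) * P.X + (14 / 100 + n / (4 * ((n : ℝ) + 1))) * P.Z +
      ((P.X : ℝ) / 8 + 10 * n + 36 + Real.log P.N + 2 * P.SAR + P.wl 0 * P.X + P.Z / 2 ^ 21) := by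
  have hmid := P.logAmaxRR_mid_le hn2
  have hbox := P.logAmaxRR_box_le
  obtain ⟨-, -, -, hNf00, -⟩ := P.nodes_le 0 0
  have hD := P.logDΔC_le 0 0 0
  have hwl := (P.wl_facts 0).2
  have hY0 := (P.YR_le 0).1
  have h1 : (P.Tf 0 0 : ℝ) * (1 + Real.log (1 + P.YR 0 / (P.Tf 0 0 : ℕ))) ≤
      P.Tf 0 0 * (P.WN + Real.log P.N + Real.log (n ! : ℝ) + 3 * Real.log ((n : ℝ) + 2) + 1) := by
    rw [← ArchG3Setup.log_DΔC hY0]; exact hD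
  have h7 : P.wl 0 * ((P.Nf 0 0 : ℕ) : ℝ) ≤ P.wl 0 * P.X := mul_le_mul_of_nonneg_left hNf00 hwl.le
  have e : (14 / 100 + n / (4 * ((n : ℝ) + 1))) * P.Z = 14 / 100 * P.Z + n / (4 * ((n : ℝ) + 1)) * P.Z := by ring
  unfold logAmaxRR SAR
  linarith only [hmid, hbox, h1, h7, e]

/-! ### The print size -/

/-- the `T₀`-part of the print size in the unit, for a box-letter `f` (`= log n!` here, `= log(κ·n)` in the κ-form) with `0 ≤ f ≤ X/32`:
`T₀·(WN + 2log N + f + 3log(n+2) + 10n + 30) + (23/160)·T₀·X + (14/100 + n/(4(n+1)))·Z ≤ (2028/1000)·Z`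
(`T₀ ≤ (33/2)(n+1)L`, the floors of `Z`). [folklore] -/
theorem print_core_le (hn2 : 2 ≤ n) {f : ℝ} (hf0 : 0 ≤ f) (hfac : f ≤ P.X / 32) :
    (P.Tf 0 0 : ℝ) * (P.WN + 2 * Real.log P.N + f + 3 * Real.log ((n : ℝ) + 2) + 10 * n + 30) +
      23 / 160 * (P.Tf 0 0 : ℝ) * P.X + (14 / 100 + n / (4 * ((n : ℝ) + 1))) * P.Z ≤ 2028 / 1000 * P.Z := by
  have hT := P.Tf00_le hn2
  obtain ⟨hZ0, hZW, hZn, hXL⟩ := P.Z_floors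
  have hN := P.N_facts
  have hlogN := P.WN_bounds.2.2.1
  have hWN1 := P.WN_bounds.1
  have hL := P.L_real.2.1
  have hn : (2 : ℝ) ≤ n := by exact_mod_cast hn2
  have hT0 : (0 : ℝ) ≤ P.Tf 0 0 := Nat.cast_nonneg _
  have hX0 : (0 : ℝ) ≤ P.X := Nat.cast_nonneg _
  -- `log(n+2) ≤ (n+2)·(10/27)` (`log y ≤ y/e`, `e ≥ 2.7`)
  have hl : Real.log ((n : ℝ) + 2) ≤ ((n : ℝ) + 2) * (10 / 27) := by
    have h1 : Real.log (((n : ℝ) + 2) / Real.exp 1) ≤ ((n : ℝ) + 2) / Real.exp 1 - 1 := Real.log_le_sub_one_of_pos (by positivity)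
    rw [Real.log_div (by positivity) (Real.exp_pos 1).ne', Real.log_exp] at h1
    have he : (27 / 10 : ℝ) ≤ Real.exp 1 := by have := Real.exp_one_gt_d9; linarith
    have h2 : ((n : ℝ) + 2) / Real.exp 1 ≤ ((n : ℝ) + 2) / (27 / 10) := div_le_div_of_nonneg_left (by positivity) (by norm_num) he
    have e : ((n : ℝ) + 2) / (27 / 10) = ((n : ℝ) + 2) * (10 / 27) := by ring
    linarith
  have hl0 : 0 ≤ Real.log ((n : ℝ) + 2) := Real.log_nonneg (by linarith)
  -- unit conversions
  have hu1 : ((n : ℝ) + 1) * P.L * P.WN ≤ P.Z / 64 := by rw [le_div_iff₀ (by norm_num)]; linarith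
  have hu2 : ((n : ℝ) + 1) * (((n : ℝ) + 1) * P.L) ≤ P.Z / 512 := by
    rw [le_div_iff₀ (by norm_num)]
    have : ((n : ℝ) + 1) * (((n : ℝ) + 1) * P.L) * 512 = 512 * ((n : ℝ) + 1) ^ 2 * P.L := by ring
    linarith
  have hu3 : ((n : ℝ) + 1) * (P.X * P.L) = P.Z / 8 := by rw [hXL, G_eq]; field_simp
  -- the bracket
  have hbr : P.WN + 2 * Real.log P.N + f + 3 * Real.log ((n : ℝ) + 2) + 10 * n + 30 ≤
      3 * P.WN + P.X / 32 + ((278/25 : ℝ) * n + (323/10 : ℝ)) := by nlinarith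
  have hbr0 : 0 ≤ P.WN + 2 * Real.log P.N + f + 3 * Real.log ((n : ℝ) + 2) + 10 * n + 30 := by
    linarith [hN.2.2]
  have hM : (P.Tf 0 0 : ℝ) * (P.WN + 2 * Real.log P.N + f + 3 * Real.log ((n : ℝ) + 2) + 10 * n + 30) ≤
      33 / 2 * (((n : ℝ) + 1) * P.L) * (3 * P.WN + P.X / 32 + ((278/25 : ℝ) * n + (323/10 : ℝ))) := by
    calc (P.Tf 0 0 : ℝ) * (P.WN + 2 * Real.log P.N + f + 3 * Real.log ((n : ℝ) + 2) + 10 * n + 30)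
        ≤ (33 / 2 * ((n : ℝ) + 1) * P.L) * (P.WN + 2 * Real.log P.N + f + 3 * Real.log ((n : ℝ) + 2) + 10 * n + 30) :=
          mul_le_mul_of_nonneg_right hT hbr0
      _ ≤ (33 / 2 * ((n : ℝ) + 1) * P.L) * (3 * P.WN + P.X / 32 + ((278/25 : ℝ) * n + (323/10 : ℝ))) :=
          mul_le_mul_of_nonneg_left hbr (by positivity)
      _ = 33 / 2 * (((n : ℝ) + 1) * P.L) * (3 * P.WN + P.X / 32 + ((278/25 : ℝ) * n + (323/10 : ℝ))) := by ring
  have hM2 : 33 / 2 * (((n : ℝ) + 1) * P.L) * (3 * P.WN + P.X / 32 + ((278/25 : ℝ) * n + (323/10 : ℝ))) =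
      33 / 2 * (((n : ℝ) + 1) * P.L) * (3 * P.WN) + 33 / 2 * (((n : ℝ) + 1) * P.L) * (P.X / 32) +
        33 / 2 * (((n : ℝ) + 1) * P.L) * ((278/25 : ℝ) * n + (323/10 : ℝ)) := by ring
  have hp1 : 33 / 2 * (((n : ℝ) + 1) * P.L) * (3 * P.WN) ≤ 99 / 128 * P.Z := by linarith
  have hp2 : 33 / 2 * (((n : ℝ) + 1) * P.L) * (P.X / 32) = 33 / 512 * P.Z := by linarith
  have hp3 : 33 / 2 * (((n : ℝ) + 1) * P.L) * ((278/25 : ℝ) * n + (323/10 : ℝ)) + n / (4 * ((n : ℝ) + 1)) * P.Z ≤ (753/1000 : ℝ) * P.Z := by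
    have hn1 : (0 : ℝ) < (n : ℝ) + 1 := by linarith
    have key : (33 / 2 * (((n : ℝ) + 1) * P.L) * ((278/25 : ℝ) * n + (323/10 : ℝ)) + n / (4 * ((n : ℝ) + 1)) * P.Z) * ((n : ℝ) + 1) ≤
        (753/1000 : ℝ) * P.Z * ((n : ℝ) + 1) := by
      have hq : (n : ℝ) / (4 * ((n : ℝ) + 1)) * ((n : ℝ) + 1) = n / 4 := by
        rw [div_mul_eq_mul_div, mul_div_mul_right _ _ hn1.ne']
      have e : (33 / 2 * (((n : ℝ) + 1) * P.L) * ((278/25 : ℝ) * n + (323/10 : ℝ)) + n / (4 * ((n : ℝ) + 1)) * P.Z) * ((n : ℝ) + 1) =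
          33 / 2 * ((278/25 : ℝ) * n + (323/10 : ℝ)) * (((n : ℝ) + 1) * (((n : ℝ) + 1) * P.L)) + n / 4 * P.Z := by
        calc (33 / 2 * (((n : ℝ) + 1) * P.L) * ((278/25 : ℝ) * n + (323/10 : ℝ)) + n / (4 * ((n : ℝ) + 1)) * P.Z) * ((n : ℝ) + 1)
            = 33 / 2 * ((278/25 : ℝ) * n + (323/10 : ℝ)) * (((n : ℝ) + 1) * (((n : ℝ) + 1) * P.L)) +
                ((n : ℝ) / (4 * ((n : ℝ) + 1)) * ((n : ℝ) + 1)) * P.Z := by ring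
          _ = 33 / 2 * ((278/25 : ℝ) * n + (323/10 : ℝ)) * (((n : ℝ) + 1) * (((n : ℝ) + 1) * P.L)) + n / 4 * P.Z := by rw [hq]
      rw [e]
      have h1 : 33 / 2 * ((278/25 : ℝ) * (n : ℝ) + (323/10 : ℝ)) * (((n : ℝ) + 1) * (((n : ℝ) + 1) * P.L)) ≤
          33 / 2 * ((278/25 : ℝ) * n + (323/10 : ℝ)) * (P.Z / 512) := mul_le_mul_of_nonneg_left hu2 (by positivity)
      have h2 : 33 / 2 * ((278/25 : ℝ) * (n : ℝ) + (323/10 : ℝ)) / 512 + n / 4 ≤ (753/1000 : ℝ) * ((n : ℝ) + 1) := by linarith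
      have h3 : 33 / 2 * ((278/25 : ℝ) * (n : ℝ) + (323/10 : ℝ)) * (P.Z / 512) + n / 4 * P.Z =
          (33 / 2 * ((278/25 : ℝ) * (n : ℝ) + (323/10 : ℝ)) / 512 + n / 4) * P.Z := by ring
      have h4 := mul_le_mul_of_nonneg_right h2 hZ0.le
      have e2 : (753/1000 : ℝ) * ((n : ℝ) + 1) * P.Z = (753/1000 : ℝ) * P.Z * ((n : ℝ) + 1) := by ring
      linarith only [h1, h3, h4, e2]
    exact le_of_mul_le_mul_right key hn1
  have hp4 : 23 / 160 * (P.Tf 0 0 : ℝ) * P.X ≤ 759 / 2560 * P.Z := by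
    have : (P.Tf 0 0 : ℝ) * P.X ≤ 33 / 2 * ((n : ℝ) + 1) * P.L * P.X := mul_le_mul_of_nonneg_right hT hX0
    have e : 33 / 2 * ((n : ℝ) + 1) * P.L * P.X = 33 / 2 * (((n : ℝ) + 1) * (P.X * P.L)) := by ring
    rw [e, hu3] at this
    linarith
  have e : (14 / 100 + n / (4 * ((n : ℝ) + 1))) * P.Z = 14 / 100 * P.Z + n / (4 * ((n : ℝ) + 1)) * P.Z := by ring
  have s1 : (P.Tf 0 0 : ℝ) * (P.WN + 2 * Real.log P.N + f + 3 * Real.log ((n : ℝ) + 2) + 10 * n + 30) ≤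
      33 / 2 * (((n : ℝ) + 1) * P.L) * (3 * P.WN) + 33 / 2 * (((n : ℝ) + 1) * P.L) * (P.X / 32) +
        33 / 2 * (((n : ℝ) + 1) * P.L) * ((278/25 : ℝ) * n + (323/10 : ℝ)) := by rw [← hM2]; exact hM
  have s2 : 33 / 2 * (((n : ℝ) + 1) * P.L) * (3 * P.WN) + 33 / 2 * (((n : ℝ) + 1) * P.L) * (P.X / 32) +
      33 / 2 * (((n : ℝ) + 1) * P.L) * ((278/25 : ℝ) * n + (323/10 : ℝ)) + n / (4 * ((n : ℝ) + 1)) * P.Z ≤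
      (99 / 128 + 33 / 512 + 753 / 1000) * P.Z := by linarith only [hp1, hp2, hp3]
  rw [e]
  generalize (P.Tf 0 0 : ℝ) * (P.WN + 2 * Real.log P.N + f + 3 * Real.log ((n : ℝ) + 2) + 10 * n + 30) = A
    at s1 ⊢
  generalize 33 / 2 * (((n : ℝ) + 1) * P.L) * (3 * P.WN) = B₁ at s1 s2 ⊢
  generalize 33 / 2 * (((n : ℝ) + 1) * P.L) * (P.X / 32) = B₂ at s1 s2 ⊢
  generalize 33 / 2 * (((n : ℝ) + 1) * P.L) * ((278/25 : ℝ) * n + (323/10 : ℝ)) = B₃ at s1 s2 ⊢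
  generalize (n : ℝ) / (4 * ((n : ℝ) + 1)) * P.Z = Q at s2 ⊢
  generalize 23 / 160 * (P.Tf 0 0 : ℝ) * P.X = C at hp4 ⊢
  linarith only [s1, s2, hp4, hZ0]

/-- **`cPR ≤ (51/25)·Z`** for `n ≥ 2`, given the factorial letter `log n! ≤ X/32`. [folklore] -/
theorem cPR_le (hn2 : 2 ≤ n) (hfac : Real.log (n ! : ℝ) ≤ P.X / 32) : P.cPR ≤ 51 / 25 * P.Z := by
  have hA := P.logAmaxRR_le hn2
  have hf0 : 0 ≤ Real.log (n ! : ℝ) := Real.log_nonneg (by exact_mod_cast Nat.one_le_iff_ne_zero.mpr (Nat.factorial_ne_zero n))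
  have hC := P.print_core_le hn2 hf0 hfac
  obtain ⟨hU, -⟩ := P.cUR_le
  have hJ := P.junk_le
  have hZ0 := P.Z_floors.1
  have hy := yloadK_ge P.hn
  have hy0 := yloadK_pos n
  have hlog := P.N_facts.2.2
  have hp5 : P.Z / (4 * yloadK n) ≤ P.Z / 392 := by
    apply div_le_div_of_nonneg_left hZ0.le (by norm_num)
    rw [G_eq] at hy
    have hn : (2 : ℝ) ≤ n := by exact_mod_cast hn2
    linarith
  have hl2 : Real.log 2 ≤ 1 := by have := Real.log_two_lt_d9; linarith
  unfold cPR
  linarith only [hA, hC, hU, hJ, hp5, hl2, hlog, hZ0]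

end ArchG3Rec

end Summit.ABC.StewartYu
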